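import Literature.RingTheory.Idempotents.InvariantsOfPermutedBlocks
import Mathlib.RingTheory.IntegralClosure.IntegrallyClosed
import Mathlib.RingTheory.Localization.FractionRing
import HarnessLib

/-!
# Invariants of a ring under a group permuting a finite family of orthogonal idempotents, FILE 2:
# the orbit blocks of the ring of invariants of a product of integrally closed domains are integrally closed domains
# (Knus–Merkurjev–Rost–Tignol, *The Book of Involutions*, proof of Prop. (18.18); Atiyah–Macdonald, Ch. 5)

Topic `Literature/RingTheory/Idempotents`, namespace `Literature.RingTheory.Idempotents`.  THEOREMS only (no def, no
instance, no notation, no named fact, no `sorry`).  Cell `hodgecm-mathlib` (D-0151), FLOOR 0, programme F0P5a, crux item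
stmt-HodgeConjecture-24832 — generic commutative-algebra capital for MOD-PLAN v0.4 row L6.6 / census `C3-LEVELS-census.v1` §5
(B2): NORMALITY of the special fibre `X_s ⧸ G` of a tame quotient, chart by chart.  Sequel of `InvariantsOfPermutedBlocks`
(FILE 1: the `G`-set of blocks, invariant block sums, the transitive piece «`(∏_{G/H} B)^G ≃ B^H`» as
`orbitSum_mul_eq_zero_of_invariant` / `exists_invariant_map_eq`).

Setting as in FILE 1: `G` acts on the commutative ring `A` by ring automorphisms permuting the orthogonal idempotents
`e : ι → A` (`hge : g • e i = e (g • i)`); `O ∋ i₀` an orbit given as a `Finset` with `hO : j ∈ O ↔ ∃ g, g • i₀ = j`;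
`ε = ∑_{j ∈ O} e j ∈ A^G = FixedPoints.subring A G` its (invariant) block sum; the block of `A` at `e i₀` is presented
by any surjection `τ : A →+* B` with `τ a = 0 ↔ e i₀ * a = 0`.

* §2 (continued from FILE 1) through a block surjection `τ`: `eq_zero_of_invariant_of_map_eq_zero` (injectivity),
  `map_smul_eq_of_map_eq_map` (images of invariants are `Stab_G(i₀)`-invariant modulo `ker τ` for every representative),
  `exists_invariant_map_eq` (surjectivity onto the `Stab_G(i₀)`-invariants).
* `isIntegrallyClosed_of_injective_of_forall_mem_range` — a ring `S` embedded in an integrally closed domain `B` and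
  containing every `b ∈ B` with `b ψ(q) = ψ(p)`, `p, q ∈ S`, `q ≠ 0`, is integrally closed (`S = B ∩ Frac S`).
* `map_eq_zero_iff_mem_span_one_sub_orbitSum` — the orbit block `A^G ⧸ (1 - ε)` EMBEDS in `B` (FILE 1 §2, injectivity).
* `isDomain_and_isIntegrallyClosed_orbitBlock` — **if `B` is an integrally closed domain then so is `A^G ⧸ (1 - ε)`**
  (FILE 1 §2 surjectivity supplies the fractions: `b τ(q) = τ(p)` forces `b` to be `Stab_G(i₀)`-invariant modulo
  `ker τ`); `…_quotient` is the case `B = A ⧸ (1 - e i₀)`, and `…_of_blocks` the assembled statement over all orbits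
  `k ∈ ι/G` for a complete family all of whose blocks are integrally closed domains — with FILE 1's
  `exists_completeOrthogonalIdempotents_fixedPoints_orbitSum` and Mathlib `CompleteOrthogonalIdempotents.bijective_pi`:
  **`A^G` is a finite product of integrally closed domains, one per orbit of blocks.**
  This is the non-integral companion of the tree's
  `Literature.AlgebraicGeometry.RelativeSpec.isIntegrallyClosed_fixedPoints_subring` (one block, `G = H`).

Deliberately NOT here: finiteness / Krull dimension of `A^G` and the smoothness of normal curves over perfect fields
(★ `Literature.AlgebraicGeometry.Resolution.NormalCurve.smooth_of_perfectField_of_isIntegrallyClosed`), the scheme-level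
gluing; no action on a quotient ring is constructed.

HC_CM is proved only modulo the 7 printed citations until rung 0 closes; this file is a generic leaf and changes no count.

## References
* [KnusEtAl1998] M.-A. Knus, A. Merkurjev, M. Rost, J.-P. Tignol, *The Book of Involutions*, AMS Coll. Publ. 44 (1998),
  §18.B, proof of Prop. (18.18) (p. 366) (`M = eL` is a field and `M^H = L^G`-descends: the averaging argument), here for
  rings and normality instead of Galois algebras over a field.
* [AtiyahMacdonald1969] M. F. Atiyah, I. G. Macdonald, *Introduction to Commutative Algebra* (1969), Ch. 5: integrally
  closed domains (p. 60) and rings of invariants of finite groups (Exercises 5.12–5.14).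
-/

set_option autoImplicit false

namespace Literature.RingTheory.Idempotents

/-! ### §2 (continued) The transitive piece through a block surjection `τ : A → B`, `τ a = 0 ↔ e i₀ a = 0` -/

section Transitive

variable {A : Type*} [CommRing A] {G : Type*} [Group G] [MulSemiringAction G A]
variable {ι : Type*} [MulAction G ι] {e : ι → A} {i₀ : ι} {O : Finset ι}
variable {B : Type*} [CommRing B]

/-- A `G`-invariant element of the orbit block whose image in the block `B` at `e i₀` vanishes is zero.
[cite: KnusEtAl1998, Prop. (18.18) (proof)] -/
theorem eq_zero_of_invariant_of_map_eq_zero (hge : ∀ (g : G) (i : ι), g • e i = e (g • i))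
    (hO : ∀ j, j ∈ O ↔ ∃ g : G, g • i₀ = j) (τ : A →+* B) (hτ : ∀ a, τ a = 0 ↔ e i₀ * a = 0)
    {a : A} (ha : ∀ g : G, g • a = a) (hεa : (∑ j ∈ O, e j) * a = a) (h : τ a = 0) : a = 0 := by
  rw [← hεa]
  exact orbitSum_mul_eq_zero_of_invariant hge hO ha ((hτ a).1 h)

/-- Two `G`-invariant elements of the orbit block with the same image in `B` are equal.
[cite: KnusEtAl1998, Prop. (18.18) (proof)] -/
theorem eq_of_invariant_of_map_eq (hge : ∀ (g : G) (i : ι), g • e i = e (g • i))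
    (hO : ∀ j, j ∈ O ↔ ∃ g : G, g • i₀ = j) (τ : A →+* B) (hτ : ∀ a, τ a = 0 ↔ e i₀ * a = 0)
    {a b : A} (ha : ∀ g : G, g • a = a) (hεa : (∑ j ∈ O, e j) * a = a)
    (hb : ∀ g : G, g • b = b) (hεb : (∑ j ∈ O, e j) * b = b) (h : τ a = τ b) : a = b := by
  rw [← sub_eq_zero] at h ⊢
  rw [← map_sub] at h
  exact eq_zero_of_invariant_of_map_eq_zero hge hO τ hτ (fun g => by rw [smul_sub, ha, hb])
    (by rw [mul_sub, hεa, hεb]) h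

/-- Images of invariants are `H`-invariant in `B`, for EVERY representative: if `τ x = τ a` with `a` `G`-invariant, then
`τ (h • x) = τ x` for all `h` in the stabiliser of `i₀` (`e i₀ (h • x) = h • (e i₀ x) = h • (e i₀ a) = e i₀ a`).
[cite: KnusEtAl1998, Prop. (18.18) (proof)] -/
theorem map_smul_eq_of_map_eq_map (hge : ∀ (g : G) (i : ι), g • e i = e (g • i))
    (τ : A →+* B) (hτ : ∀ a, τ a = 0 ↔ e i₀ * a = 0)
    {a : A} (ha : ∀ g : G, g • a = a) {x : A} (hx : τ x = τ a) {g : G} (hg : g • i₀ = i₀) :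
    τ (g • x) = τ x := by
  have h1 : e i₀ * x = e i₀ * a := by
    rw [← sub_eq_zero, ← mul_sub, ← hτ, map_sub, hx, sub_self]
  rw [← sub_eq_zero, ← map_sub, hτ, mul_sub, sub_eq_zero, h1]
  calc e i₀ * g • x = g • (e i₀ * x) := by rw [smul_idem_mul hge, hg]
    _ = e i₀ * a := by rw [h1, smul_idem_mul hge, hg, ha]

/-- **Surjectivity through `τ`.**  An element of `B` represented by some `x` that is `H`-invariant modulo `ker τ`
(`τ (h • x) = τ x` for `h ∈ Stab_G(i₀)`) is the image of a `G`-INVARIANT element of the orbit block.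
[cite: KnusEtAl1998, Prop. (18.18) (proof)] -/
theorem exists_invariant_map_eq (he : OrthogonalIdempotents e)
    (hge : ∀ (g : G) (i : ι), g • e i = e (g • i)) (hO : ∀ j, j ∈ O ↔ ∃ g : G, g • i₀ = j)
    (τ : A →+* B) (hτ : ∀ a, τ a = 0 ↔ e i₀ * a = 0)
    (x : A) (hH : ∀ g : G, g • i₀ = i₀ → τ (g • x) = τ x) :
    ∃ a : A, (∀ g : G, g • a = a) ∧ (∑ j ∈ O, e j) * a = a ∧ τ a = τ x := by
  -- replace `x` by its corner component `y = e i₀ x`, which is `H`-invariant on the nose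
  have hy : e i₀ * (e i₀ * x) = e i₀ * x := by rw [← mul_assoc, (he.idem i₀).eq]
  have hHy : ∀ g : G, g • i₀ = i₀ → g • (e i₀ * x) = e i₀ * x := fun g hg => by
    rw [smul_idem_mul hge, hg, ← sub_eq_zero, ← mul_sub, ← hτ, map_sub, sub_eq_zero, hH g hg]
  obtain ⟨a, ha, hεa, hax⟩ := exists_invariant_of_stabilizer he hge hO hy hHy
  refine ⟨a, ha, hεa, ?_⟩
  rw [← sub_eq_zero, ← map_sub, hτ, mul_sub, hax, sub_self]

end Transitive

/-! ### §3 Normality transfer: the orbit blocks of the ring of invariants -/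

section Normal

variable {A : Type*} [CommRing A] {G : Type*} [Group G] [MulSemiringAction G A]
variable {ι : Type*} [MulAction G ι] {e : ι → A} {i₀ : ι} {O : Finset ι}
variable {B : Type*} [CommRing B]

/-- The orbit block of the ring of invariants EMBEDS into the block `B` at `e i₀`: the ring map
`A^G ⧸ (1 - ε) → B` induced by `τ` (well defined since `e i₀ (1 - ε) = 0`) is injective.  Stated without naming the map:
for `r ∈ A^G`, `τ r = 0 ↔ r ∈ (1 - ε) A^G`. [cite: KnusEtAl1998, Prop. (18.18) (proof)] -/
theorem map_eq_zero_iff_mem_span_one_sub_orbitSum (he : OrthogonalIdempotents e)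
    (hge : ∀ (g : G) (i : ι), g • e i = e (g • i)) (hO : ∀ j, j ∈ O ↔ ∃ g : G, g • i₀ = j)
    (τ : A →+* B) (hτ : ∀ a, τ a = 0 ↔ e i₀ * a = 0)
    (ε : FixedPoints.subring A G) (hε : (ε : A) = ∑ j ∈ O, e j) (r : FixedPoints.subring A G) :
    τ r = 0 ↔ r ∈ Ideal.span {1 - ε} := by
  have hεidem : IsIdempotentElem ε := by
    apply Subtype.ext
    change (ε : A) * ε = ε
    rw [hε]
    exact he.isIdempotentElem_sum.eq
  rw [← mul_eq_zero_iff_mem_span_one_sub hεidem, hτ]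
  constructor
  · intro h
    apply Subtype.ext
    change (ε : A) * r = 0
    rw [hε]
    exact orbitSum_mul_eq_zero_of_invariant hge hO r.2 h
  · intro h
    have h' : (ε : A) * r = 0 := congr_arg Subtype.val h
    rw [hε] at h'
    calc e i₀ * (r : A) = e i₀ * ((∑ j ∈ O, e j) * r) := by
          rw [← mul_assoc, he.mul_sum_of_mem (mem_of_orbitSpec hO)]
      _ = 0 := by rw [h', mul_zero]

/-- **A subring `S ⊆ B` of an integrally closed domain containing every element of `B` that is a FRACTION of
elements of `S` is integrally closed** (`S = B ∩ Frac S` inside `Frac B`): an element of `Frac S` integral over `S` is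
integral over `B`, hence in `B`, hence in `S`.  Stated for an injective ring map `ψ : S → B`. [cite: AtiyahMacdonald1969, Ch. 5, p. 60 (integrally closed domains) and Ex. 5.12–5.14 (rings of invariants)] -/
theorem isIntegrallyClosed_of_injective_of_forall_mem_range {S : Type*} [CommRing S] [IsDomain S]
    {B : Type*} [CommRing B] [IsDomain B] [IsIntegrallyClosed B] (ψ : S →+* B) (hψ : Function.Injective ψ)
    (hrange : ∀ (b : B) (p q : S), q ≠ 0 → b * ψ q = ψ p → b ∈ Set.range ψ) : IsIntegrallyClosed S := by
  have hinj : Function.Injective ((algebraMap B (FractionRing B)).comp ψ) :=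
    (IsFractionRing.injective B (FractionRing B)).comp hψ
  have hφ : ∀ q : S, IsFractionRing.lift hinj (algebraMap S (FractionRing S) q) =
      algebraMap B (FractionRing B) (ψ q) := fun q => IsFractionRing.lift_algebraMap hinj q
  refine (isIntegrallyClosed_iff (FractionRing S)).mpr fun {z} hz => ?_
  have hzB : IsIntegral B (IsFractionRing.lift hinj z) :=
    hz.map_of_comp_eq ψ (IsFractionRing.lift hinj) (by ext q; exact (hφ q).symm)
  obtain ⟨b, hb⟩ := IsIntegrallyClosed.algebraMap_eq_of_integral hzB
  obtain ⟨p, q, hq, rfl⟩ := IsFractionRing.div_surjective (A := S) z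
  have hq0 : q ≠ 0 := nonZeroDivisors.ne_zero hq
  have hψq : ψ q ≠ 0 := fun h => hq0 (hψ (by rw [h, map_zero]))
  have hLq : algebraMap B (FractionRing B) (ψ q) ≠ 0 := fun h =>
    hψq (IsFractionRing.injective B (FractionRing B) (by rw [h, map_zero]))
  have hbq : b * ψ q = ψ p := by
    apply IsFractionRing.injective B (FractionRing B)
    rw [map_mul, hb, map_div₀, hφ, hφ, div_mul_cancel₀ _ hLq]
  obtain ⟨s, hs⟩ := hrange b p q hq0 hbq
  refine ⟨s, (IsFractionRing.lift hinj).injective ?_⟩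
  rw [hφ, hs, hb]

/-- **Normality transfer (the orbit block of the invariants is an integrally closed domain).**  Let `G` act on the
commutative ring `A` permuting the orthogonal idempotents `e`, let `O ∋ i₀` be an orbit with block sum
`ε = ∑_{j ∈ O} e j ∈ A^G`, and let `τ : A → B` be a surjection onto an INTEGRALLY CLOSED DOMAIN with
`τ a = 0 ↔ e i₀ a = 0` (the block of `A` at `e i₀`).  Then the orbit block `A^G ⧸ (1 - ε)` of the ring of invariants
`A^G = FixedPoints.subring A G` is an integrally closed domain.  (It embeds into `B` by
`map_eq_zero_iff_mem_span_one_sub_orbitSum`; if `b τ(q) = τ(p)` with `p, q` invariant and `τ(q) ≠ 0`, cancelling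
`τ(q)` in the domain `B` shows `b` is `H`-invariant modulo `ker τ`, so `b = τ(r)` with `r` invariant by
`exists_invariant_map_eq`; now apply `isIntegrallyClosed_of_injective_of_forall_mem_range`.)  This is
«`(∏_{G/H} B)^G ≃ B^H`» combined with «invariants of an integrally closed domain are integrally closed»
(`Literature.AlgebraicGeometry.RelativeSpec.isIntegrallyClosed_fixedPoints_subring`, the one-block case).
[cite: KnusEtAl1998, Prop. (18.18) (proof)] -/
theorem isDomain_and_isIntegrallyClosed_orbitBlock [IsDomain B] [IsIntegrallyClosed B]
    (he : OrthogonalIdempotents e)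
    (hge : ∀ (g : G) (i : ι), g • e i = e (g • i)) (hO : ∀ j, j ∈ O ↔ ∃ g : G, g • i₀ = j)
    (τ : A →+* B) (hτs : Function.Surjective τ) (hτ : ∀ a, τ a = 0 ↔ e i₀ * a = 0)
    (ε : FixedPoints.subring A G) (hε : (ε : A) = ∑ j ∈ O, e j) :
    IsDomain (FixedPoints.subring A G ⧸ Ideal.span {1 - ε}) ∧
      IsIntegrallyClosed (FixedPoints.subring A G ⧸ Ideal.span {1 - ε}) := by
  -- the induced map `ψ : A^G ⧸ (1 - ε) → B`
  have hJ : ∀ r ∈ Ideal.span ({1 - ε} : Set (FixedPoints.subring A G)),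
      τ.comp (FixedPoints.subring A G).subtype r = 0 :=
    fun r hr => (map_eq_zero_iff_mem_span_one_sub_orbitSum he hge hO τ hτ ε hε r).2 hr
  have hψmk : ∀ r : FixedPoints.subring A G,
      Ideal.Quotient.lift _ _ hJ (Ideal.Quotient.mk (Ideal.span {1 - ε}) r) = τ r :=
    fun r => Ideal.Quotient.lift_mk _ _ hJ
  have hψinj : Function.Injective (Ideal.Quotient.lift _ _ hJ) := by
    rw [injective_iff_map_eq_zero]
    intro q hq
    obtain ⟨r, rfl⟩ := Ideal.Quotient.mk_surjective q
    rw [hψmk] at hq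
    exact Ideal.Quotient.eq_zero_iff_mem.2
      ((map_eq_zero_iff_mem_span_one_sub_orbitSum he hge hO τ hτ ε hε r).1 hq)
  haveI hdom : IsDomain (FixedPoints.subring A G ⧸ Ideal.span {1 - ε}) :=
    hψinj.isDomain (Ideal.Quotient.lift _ _ hJ)
  refine ⟨hdom, isIntegrallyClosed_of_injective_of_forall_mem_range _ hψinj fun b p q hq0 hbq => ?_⟩
  obtain ⟨rp, rfl⟩ := Ideal.Quotient.mk_surjective p
  obtain ⟨rq, rfl⟩ := Ideal.Quotient.mk_surjective q
  rw [hψmk, hψmk] at hbq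
  have hq0' : τ (rq : A) ≠ 0 := by
    rw [← hψmk]
    exact fun h => hq0 (hψinj (by rw [h, map_zero]))
  -- a representative `x₀` of `b` is `H`-invariant modulo `ker τ`
  obtain ⟨x₀, rfl⟩ := hτs b
  have hHx : ∀ g : G, g • i₀ = i₀ → τ (g • x₀) = τ x₀ := fun g hg => by
    have h1 : τ (g • (x₀ * rq)) = τ (x₀ * rq) :=
      map_smul_eq_of_map_eq_map hge τ hτ rp.2 (x := x₀ * rq) (by rw [map_mul, hbq]) hg
    rw [smul_mul', rq.2 g, map_mul, map_mul] at h1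
    exact mul_right_cancel₀ hq0' h1
  obtain ⟨r, hr, -, hrx⟩ := exists_invariant_map_eq he hge hO τ hτ x₀ hHx
  exact ⟨Ideal.Quotient.mk _ ⟨r, hr⟩, by rw [hψmk]; exact hrx⟩

/-- **Normality transfer for the standard blocks.**  If the block `A ⧸ (1 - e i₀)` of `A` is an integrally closed
domain, then so is the orbit block `A^G ⧸ (1 - ∑_{j ∈ G i₀} e j)` of the ring of invariants
(`isDomain_and_isIntegrallyClosed_orbitBlock` with `τ = Ideal.Quotient.mk _`).  Consequently, when `A` is a finite
product of integrally closed domains whose blocks `G` permutes (`e` complete), `A^G ≅ ∏_{orbits} A^G ⧸ (1 - ε_O)`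
(`completeOrthogonalIdempotents_fiberSum` + Mathlib `CompleteOrthogonalIdempotents.bijective_pi`) is a finite product
of integrally closed domains. [cite: KnusEtAl1998, Prop. (18.18) (proof)] -/
theorem isDomain_and_isIntegrallyClosed_orbitBlock_quotient
    [IsDomain (A ⧸ Ideal.span {1 - e i₀})] [IsIntegrallyClosed (A ⧸ Ideal.span {1 - e i₀})]
    (he : OrthogonalIdempotents e)
    (hge : ∀ (g : G) (i : ι), g • e i = e (g • i)) (hO : ∀ j, j ∈ O ↔ ∃ g : G, g • i₀ = j)
    (ε : FixedPoints.subring A G) (hε : (ε : A) = ∑ j ∈ O, e j) :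
    IsDomain (FixedPoints.subring A G ⧸ Ideal.span {1 - ε}) ∧
      IsIntegrallyClosed (FixedPoints.subring A G ⧸ Ideal.span {1 - ε}) :=
  isDomain_and_isIntegrallyClosed_orbitBlock he hge hO (Ideal.Quotient.mk (Ideal.span {1 - e i₀}))
    Ideal.Quotient.mk_surjective (mk_span_one_sub_eq_zero_iff (he.idem i₀)) ε hε

/-- **The ring of invariants of a finite product of integrally closed domains permuted by a group is a finite product
of integrally closed domains, one per orbit.**  For a finite `G`-set `ι` and a `G`-permuted COMPLETE orthogonal family
`e` all of whose blocks `A ⧸ (1 - e i)` are integrally closed domains, every orbit block `A^G ⧸ (1 - ε_k)` (`k ∈ ι/G`,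
`ε_k = ∑_{j ∈ k} e j`, the complete orthogonal family of `A^G` from
`exists_completeOrthogonalIdempotents_fixedPoints_orbitSum`) is an integrally closed domain.
[cite: KnusEtAl1998, Prop. (18.18) (proof)] -/
theorem isDomain_and_isIntegrallyClosed_orbitBlock_of_blocks [Fintype ι]
    [DecidableEq (MulAction.orbitRel.Quotient G ι)] (he : CompleteOrthogonalIdempotents e)
    (hge : ∀ (g : G) (i : ι), g • e i = e (g • i))
    (hB : ∀ i, IsDomain (A ⧸ Ideal.span {1 - e i}) ∧ IsIntegrallyClosed (A ⧸ Ideal.span {1 - e i}))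
    (k : MulAction.orbitRel.Quotient G ι) (ε : FixedPoints.subring A G)
    (hε : (ε : A) = ∑ j ∈ Finset.univ.filter (fun j => (Quotient.mk (MulAction.orbitRel G ι) j :
          MulAction.orbitRel.Quotient G ι) = k), e j) :
    IsDomain (FixedPoints.subring A G ⧸ Ideal.span {1 - ε}) ∧
      IsIntegrallyClosed (FixedPoints.subring A G ⧸ Ideal.span {1 - ε}) := by
  obtain ⟨i₀, rfl⟩ := Quotient.exists_rep k
  haveI := (hB i₀).1
  haveI := (hB i₀).2
  exact isDomain_and_isIntegrallyClosed_orbitBlock_quotient he.toOrthogonalIdempotents hge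
    (mem_filter_orbitRel_iff i₀) ε hε

end Normal

end Literature.RingTheory.Idempotents
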